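import Literature.Analysis.OperatorTheory.HeterogeneousCyclicPeeling
import HarnessLib

/-!
# Route `BalabanLadder`, crux `IR` (stmt-QuantumFields-19354): SLAB DECOUPLING, part 1 — cutting a cyclic kernel chain

Instrument seat `ym-ir-eng-4` (generation g5), cell `pub/ym-ir` — the model-free half of the kernel purity bound of
`BalabanLadderIRColdPuritySlabDecoupling.lean` (`--supports stmt-QuantumFields-19354`; no registered stub is claimed).

**The estimate.**  Let `(Y, μ)` be a finite measure space, `K : Y → Y → ℝ` a measurable kernel and
`a : Y → [0, 1]` measurable with the TWO-SIDED RANK-ONE BOUND `e^{-c} · a(x) a(y) ≤ K(x, y) ≤ a(x) a(y)`.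
Then for every `t ≥ 1`, with `Z(N) := ∫ ∏_{i : Fin N} K(V i, V (i+1)) dμ^{⊗N}(V)` (indices mod `N`, the path-space
form of `Tr 𝕋^N` of the tree's `KernelCyclicPeeling` / `HeterogeneousCyclicPeeling`),
`Z(t)² ≤ e^{2c} · Z(2t)`  (`sq_integral_cyclicProd_le_exp_mul_integral_cyclicProd`).
Proof: cut ONE bond of the `t`-cycle with the upper bound — `Z(t) ≤ Q(t)`, `Q(t)` the OPEN chain capped by `a` at both
ends — and the two antipodal bonds of the `2t`-cycle with the lower bound — `Z(2t) ≥ e^{-2c} Q(t)²`, the product measure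
splitting along `Fin (t + t) ≃ Fin t ⊕ Fin t` (`measurePreserving_finSplit`).  Elementary; no expansion; uniform in `t`.

HONEST FRAMING.  Pure measure theory (a folklore transfer-matrix manipulation written on path space); nothing here is
specific to gauge theory, and nothing here or in part 2 bears on THE NUMBER `PX`/`PXcof` (β → ∞), on `BalabanLadder.IR` /
`.IRcof` (0/1) or on the Yang–Mills mass gap (Clay), which is NOT proved by any of this; R4 closes only the conditional
finite-𝕋⁴ rung `BalabanLadder.UV`.
-/

noncomputable section

open MeasureTheory Filter Set Function

namespace Summit.QuantumFields.YangMills.Cruxes.IR.ColdPuritySlabDecoupling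

open Literature.Analysis.OperatorTheory

/-! ### Index arithmetic on the cycles `Fin (s+1)` and `Fin ((s+1)+(s+1))` -/

section Index

/-- `(i + 1).val = (i.val + 1) % m` in `Fin m`. [folklore] -/
theorem fin_val_add_one_eq_mod {m : ℕ} [NeZero m] (i : Fin m) : ((i + 1 : Fin m) : ℕ) = (i.val + 1) % m := by
  rw [Fin.val_add, Fin.val_one', Nat.add_mod_mod]

variable {s : ℕ} [NeZero ((s + 1) + (s + 1))]

/-- First block, interior bond: `castAdd (castSucc j) + 1 = castAdd (succ j)` on `Fin ((s+1)+(s+1))`. [folklore] -/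
theorem castAdd_castSucc_add_one (j : Fin s) :
    (Fin.castAdd (s + 1) (Fin.castSucc j) : Fin ((s + 1) + (s + 1))) + 1 = Fin.castAdd (s + 1) j.succ := by
  rw [Fin.ext_iff, fin_val_add_one_eq_mod, Fin.val_castAdd, Fin.val_castAdd, Fin.val_castSucc, Fin.val_succ]
  exact Nat.mod_eq_of_lt (by omega)

/-- First block, last bond: `castAdd (last s) + 1 = natAdd 0` on `Fin ((s+1)+(s+1))`. [folklore] -/
theorem castAdd_last_add_one :
    (Fin.castAdd (s + 1) (Fin.last s) : Fin ((s + 1) + (s + 1))) + 1 = Fin.natAdd (s + 1) (0 : Fin (s + 1)) := by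
  rw [Fin.ext_iff, fin_val_add_one_eq_mod, Fin.val_castAdd, Fin.val_natAdd, Fin.val_last, Fin.val_zero]
  exact Nat.mod_eq_of_lt (by omega)

/-- Second block, interior bond: `natAdd (castSucc j) + 1 = natAdd (succ j)` on `Fin ((s+1)+(s+1))`. [folklore] -/
theorem natAdd_castSucc_add_one (j : Fin s) :
    (Fin.natAdd (s + 1) (Fin.castSucc j) : Fin ((s + 1) + (s + 1))) + 1 = Fin.natAdd (s + 1) j.succ := by
  rw [Fin.ext_iff, fin_val_add_one_eq_mod, Fin.val_natAdd, Fin.val_natAdd, Fin.val_castSucc, Fin.val_succ]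
  have hj := j.isLt
  rw [Nat.mod_eq_of_lt (by omega)]
  omega

/-- Second block, last bond (closing the cycle): `natAdd (last s) + 1 = castAdd 0` on `Fin ((s+1)+(s+1))`. [folklore] -/
theorem natAdd_last_add_one :
    (Fin.natAdd (s + 1) (Fin.last s) : Fin ((s + 1) + (s + 1))) + 1 = Fin.castAdd (s + 1) (0 : Fin (s + 1)) := by
  rw [Fin.ext_iff, fin_val_add_one_eq_mod, Fin.val_natAdd, Fin.val_castAdd, Fin.val_last, Fin.val_zero,
    show s + 1 + s + 1 = (s + 1) + (s + 1) by omega, Nat.mod_self]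

end Index

/-! ### The cut estimate -/

section Pointwise

variable {Y : Type*} {K : Y → Y → ℝ} {a : Y → ℝ} {c : ℝ}

/-- Under `0 ≤ a ≤ 1` and `e^{-c} a(x)a(y) ≤ K(x,y) ≤ a(x)a(y)`: `0 ≤ K ≤ 1`. [folklore] -/
theorem kernel_nonneg_le_one (ha0 : ∀ x, 0 ≤ a x) (ha1 : ∀ x, a x ≤ 1)
    (hlo : ∀ x y, Real.exp (-c) * (a x * a y) ≤ K x y) (hhi : ∀ x y, K x y ≤ a x * a y) (x y : Y) :
    0 ≤ K x y ∧ K x y ≤ 1 :=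
  ⟨le_trans (mul_nonneg (Real.exp_pos _).le (mul_nonneg (ha0 x) (ha0 y))) (hlo x y),
    (hhi x y).trans (mul_le_one₀ (ha1 x) (ha0 y) (ha1 y))⟩

/-- **Cutting one bond of the `t`-cycle (upper bound).**  Pointwise,
`∏_{i : Fin (s+1)} K(V i, V (i+1)) ≤ a(V 0) a(V last) ∏_{j : Fin s} K(V j, V (j+1))` when `K ≤ a ⊗ a` and `K ≥ 0`.
[folklore] -/
theorem cyclicProd_le_openProd (ha0 : ∀ x, 0 ≤ a x) (ha1 : ∀ x, a x ≤ 1)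
    (hlo : ∀ x y, Real.exp (-c) * (a x * a y) ≤ K x y) (hhi : ∀ x y, K x y ≤ a x * a y)
    (s : ℕ) (V : Fin (s + 1) → Y) :
    ∏ i, K (V i) (V (i + 1)) ≤
      a (V 0) * a (V (Fin.last s)) * ∏ j : Fin s, K (V (Fin.castSucc j)) (V j.succ) := by
  rw [Fin.prod_univ_castSucc, Fin.last_add_one]
  simp only [Fin.coeSucc_eq_succ]
  have hP : 0 ≤ ∏ j : Fin s, K (V (Fin.castSucc j)) (V j.succ) :=
    Finset.prod_nonneg fun j _ => (kernel_nonneg_le_one ha0 ha1 hlo hhi _ _).1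
  calc (∏ j : Fin s, K (V (Fin.castSucc j)) (V j.succ)) * K (V (Fin.last s)) (V 0)
      ≤ (∏ j : Fin s, K (V (Fin.castSucc j)) (V j.succ)) * (a (V (Fin.last s)) * a (V 0)) :=
        mul_le_mul_of_nonneg_left (hhi _ _) hP
    _ = a (V 0) * a (V (Fin.last s)) * ∏ j : Fin s, K (V (Fin.castSucc j)) (V j.succ) := by ring

/-- **Cutting two antipodal bonds of the `2t`-cycle (lower bound).**  Pointwise on `Fin ((s+1)+(s+1))`,
`∏ᵢ K(V i, V (i+1)) ≥ e^{-2c} · F(V ∘ castAdd) · F(V ∘ natAdd)` with `F` the capped open-chain weight, when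
`e^{-c} a ⊗ a ≤ K` and `K ≥ 0`. [folklore] -/
theorem exp_mul_openProd_mul_openProd_le_cyclicProd {s : ℕ} [NeZero ((s + 1) + (s + 1))] (ha0 : ∀ x, 0 ≤ a x)
    (ha1 : ∀ x, a x ≤ 1) (hlo : ∀ x y, Real.exp (-c) * (a x * a y) ≤ K x y) (hhi : ∀ x y, K x y ≤ a x * a y)
    (V : Fin ((s + 1) + (s + 1)) → Y) :
    Real.exp (-(2 * c)) *
        ((a (V (Fin.castAdd (s + 1) 0)) * a (V (Fin.castAdd (s + 1) (Fin.last s))) *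
            ∏ j : Fin s, K (V (Fin.castAdd (s + 1) (Fin.castSucc j))) (V (Fin.castAdd (s + 1) j.succ))) *
          (a (V (Fin.natAdd (s + 1) 0)) * a (V (Fin.natAdd (s + 1) (Fin.last s))) *
            ∏ j : Fin s, K (V (Fin.natAdd (s + 1) (Fin.castSucc j))) (V (Fin.natAdd (s + 1) j.succ)))) ≤
      ∏ i, K (V i) (V (i + 1)) := by
  rw [Fin.prod_univ_add, Fin.prod_univ_castSucc, Fin.prod_univ_castSucc, castAdd_last_add_one,
    natAdd_last_add_one]
  simp only [castAdd_castSucc_add_one, natAdd_castSucc_add_one]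
  set A := ∏ j : Fin s, K (V (Fin.castAdd (s + 1) (Fin.castSucc j))) (V (Fin.castAdd (s + 1) j.succ)) with hA
  set B := ∏ j : Fin s, K (V (Fin.natAdd (s + 1) (Fin.castSucc j))) (V (Fin.natAdd (s + 1) j.succ)) with hB
  have hK0 : ∀ x y, 0 ≤ K x y := fun x y => (kernel_nonneg_le_one ha0 ha1 hlo hhi x y).1
  have hA0 : 0 ≤ A := Finset.prod_nonneg fun j _ => hK0 _ _
  have hB0 : 0 ≤ B := Finset.prod_nonneg fun j _ => hK0 _ _
  set x₀ := V (Fin.castAdd (s + 1) 0)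
  set xₗ := V (Fin.castAdd (s + 1) (Fin.last s))
  set y₀ := V (Fin.natAdd (s + 1) 0)
  set yₗ := V (Fin.natAdd (s + 1) (Fin.last s))
  have h1 : Real.exp (-c) * (a xₗ * a y₀) ≤ K xₗ y₀ := hlo _ _
  have h2 : Real.exp (-c) * (a yₗ * a x₀) ≤ K yₗ x₀ := hlo _ _
  have he : Real.exp (-(2 * c)) = Real.exp (-c) * Real.exp (-c) := by
    rw [← Real.exp_add]; ring_nf
  have hnn1 : 0 ≤ Real.exp (-c) * (a xₗ * a y₀) := mul_nonneg (Real.exp_pos _).le (mul_nonneg (ha0 _) (ha0 _))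
  have hnn2 : 0 ≤ Real.exp (-c) * (a yₗ * a x₀) := mul_nonneg (Real.exp_pos _).le (mul_nonneg (ha0 _) (ha0 _))
  calc Real.exp (-(2 * c)) * ((a x₀ * a xₗ * A) * (a y₀ * a yₗ * B))
      = (A * (Real.exp (-c) * (a xₗ * a y₀))) * (B * (Real.exp (-c) * (a yₗ * a x₀))) := by rw [he]; ring
    _ ≤ (A * K xₗ y₀) * (B * K yₗ x₀) :=
        mul_le_mul (mul_le_mul_of_nonneg_left h1 hA0) (mul_le_mul_of_nonneg_left h2 hB0)
          (mul_nonneg hB0 hnn2) (mul_nonneg hA0 (hK0 _ _))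

end Pointwise

section Cut

variable {Y : Type*} [MeasurableSpace Y] {μ : Measure Y} [IsFiniteMeasure μ]
  {K : Y → Y → ℝ} {a : Y → ℝ} {c : ℝ}

/-- Measurability of the cyclic weight `V ↦ ∏ᵢ K(V i, V (i+1))` on `Fin m`. [folklore] -/
theorem measurable_cyclicProd (hK : Measurable (uncurry K)) (m : ℕ) [NeZero m] :
    Measurable fun V : Fin m → Y => ∏ i, K (V i) (V (i + 1)) := by
  refine Finset.measurable_prod _ fun i _ => ?_
  have h := hK.comp ((measurable_pi_apply (X := fun _ : Fin m => Y) i).prodMk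
    (measurable_pi_apply (X := fun _ : Fin m => Y) (i + 1)))
  exact h

/-- Measurability of the capped open-chain weight `W ↦ a(W 0) a(W last) ∏_{j} K(W j, W (j+1))` on `Fin (s+1)`.
[folklore] -/
theorem measurable_openProd (hK : Measurable (uncurry K)) (ha : Measurable a) (s : ℕ) :
    Measurable fun W : Fin (s + 1) → Y =>
      a (W 0) * a (W (Fin.last s)) * ∏ j : Fin s, K (W (Fin.castSucc j)) (W j.succ) := by
  refine ((ha.comp (measurable_pi_apply 0)).mul (ha.comp (measurable_pi_apply _))).mul ?_
  refine Finset.measurable_prod _ fun j _ => ?_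
  have h := hK.comp ((measurable_pi_apply (X := fun _ : Fin (s + 1) => Y) (Fin.castSucc j)).prodMk
    (measurable_pi_apply (X := fun _ : Fin (s + 1) => Y) j.succ))
  exact h

/-- **The product measure splits along `Fin (t+t) ≃ Fin t ⊕ Fin t`**: for a bounded measurable `F`,
`∫ F(V ∘ castAdd) F(V ∘ natAdd) dμ^{⊗(t+t)}(V) = (∫ F dμ^{⊗t})²`. [folklore] -/
theorem integral_mul_comp_castAdd_natAdd (t : ℕ) (F : (Fin t → Y) → ℝ) :
    ∫ V : Fin (t + t) → Y, F (fun i => V (Fin.castAdd t i)) * F (fun j => V (Fin.natAdd t j))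
        ∂(Measure.pi fun _ => μ) =
      (∫ W, F W ∂(Measure.pi fun _ : Fin t => μ)) * ∫ W, F W ∂(Measure.pi fun _ : Fin t => μ) := by
  have h := measurePreserving_finSplit (ρ := μ) (Y := Y) t t
  rw [← integral_prod_mul F F, ← h.integral_comp' (g := fun p => F p.1 * F p.2)]
  rfl

/-- **THE CUT ESTIMATE: `Z(t)² ≤ e^{2c} · Z(2t)`.**  For a finite measure `μ`, a measurable kernel `K` and a
measurable `a : Y → [0,1]` with `e^{-c} a(x)a(y) ≤ K(x,y) ≤ a(x)a(y)`, and `t ≥ 1`, `m = t + t`: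
`(∫ ∏_{i : Fin t} K(V i, V (i+1)) dμ^{⊗t})² ≤ e^{2c} ∫ ∏_{i : Fin m} K(V i, V (i+1)) dμ^{⊗m}`
— one bond of the short cycle is cut from above, two antipodal bonds of the long cycle from below, against the
same capped open chain. [folklore] -/
theorem sq_integral_cyclicProd_le_exp_mul_integral_cyclicProd (hK : Measurable (uncurry K))
    (ha : Measurable a) (ha0 : ∀ x, 0 ≤ a x) (ha1 : ∀ x, a x ≤ 1)
    (hlo : ∀ x y, Real.exp (-c) * (a x * a y) ≤ K x y) (hhi : ∀ x y, K x y ≤ a x * a y)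
    {t m : ℕ} [NeZero t] [NeZero m] (hm : m = t + t) :
    (∫ V : Fin t → Y, ∏ i, K (V i) (V (i + 1)) ∂(Measure.pi fun _ => μ)) ^ 2 ≤
      Real.exp (2 * c) * ∫ V : Fin m → Y, ∏ i, K (V i) (V (i + 1)) ∂(Measure.pi fun _ => μ) := by
  obtain ⟨s, rfl⟩ : ∃ s, t = s + 1 := ⟨t - 1, by have := NeZero.ne t; omega⟩
  subst hm
  -- the three functionals
  set F : (Fin (s + 1) → Y) → ℝ :=
    fun W => a (W 0) * a (W (Fin.last s)) * ∏ j : Fin s, K (W (Fin.castSucc j)) (W j.succ) with hF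
  have hK01 := kernel_nonneg_le_one ha0 ha1 hlo hhi
  have hF01 : ∀ W, 0 ≤ F W ∧ F W ≤ 1 := fun W => by
    have hp0 : 0 ≤ ∏ j : Fin s, K (W (Fin.castSucc j)) (W j.succ) := Finset.prod_nonneg fun j _ => (hK01 _ _).1
    have hp1 : ∏ j : Fin s, K (W (Fin.castSucc j)) (W j.succ) ≤ 1 :=
      Finset.prod_le_one (fun j _ => (hK01 _ _).1) fun j _ => (hK01 _ _).2
    exact ⟨mul_nonneg (mul_nonneg (ha0 _) (ha0 _)) hp0,
      mul_le_one₀ (mul_le_one₀ (ha1 _) (ha0 _) (ha1 _)) hp0 hp1⟩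
  have hP01 : ∀ (k : ℕ) [NeZero k] (V : Fin k → Y),
      0 ≤ ∏ i, K (V i) (V (i + 1)) ∧ ∏ i, K (V i) (V (i + 1)) ≤ 1 := fun k _ V =>
    ⟨Finset.prod_nonneg fun i _ => (hK01 _ _).1,
      Finset.prod_le_one (fun i _ => (hK01 _ _).1) fun i _ => (hK01 _ _).2⟩
  -- integrability (bounded measurable on a finite measure)
  have hintP : ∀ (k : ℕ) [NeZero k],
      Integrable (fun V : Fin k → Y => ∏ i, K (V i) (V (i + 1))) (Measure.pi fun _ => μ) := fun k _ =>
    Integrable.of_bound (measurable_cyclicProd hK k).aestronglyMeasurable 1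
      (Eventually.of_forall fun V => by
        rw [Real.norm_eq_abs, abs_of_nonneg (hP01 k V).1]; exact (hP01 k V).2)
  have hintF : Integrable F (Measure.pi fun _ : Fin (s + 1) => μ) :=
    Integrable.of_bound (measurable_openProd hK ha s).aestronglyMeasurable 1
      (Eventually.of_forall fun W => by
        rw [Real.norm_eq_abs, abs_of_nonneg (hF01 W).1]; exact (hF01 W).2)
  have hg1 : Measurable fun (V : Fin ((s + 1) + (s + 1)) → Y) (i : Fin (s + 1)) => V (Fin.castAdd (s + 1) i) :=
    measurable_pi_lambda _ fun i => measurable_pi_apply (X := fun _ : Fin ((s + 1) + (s + 1)) => Y) _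
  have hg2 : Measurable fun (V : Fin ((s + 1) + (s + 1)) → Y) (j : Fin (s + 1)) => V (Fin.natAdd (s + 1) j) :=
    measurable_pi_lambda _ fun j => measurable_pi_apply (X := fun _ : Fin ((s + 1) + (s + 1)) => Y) _
  have hmF : Measurable F := measurable_openProd hK ha s
  have hmeasFF : Measurable fun V : Fin ((s + 1) + (s + 1)) → Y =>
      F (fun i => V (Fin.castAdd (s + 1) i)) * F (fun j => V (Fin.natAdd (s + 1) j)) :=
    (hmF.comp hg1).mul (hmF.comp hg2)
  have hintFF : Integrable (fun V : Fin ((s + 1) + (s + 1)) → Y =>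
      Real.exp (-(2 * c)) * (F (fun i => V (Fin.castAdd (s + 1) i)) * F (fun j => V (Fin.natAdd (s + 1) j))))
      (Measure.pi fun _ => μ) := by
    refine (Integrable.of_bound hmeasFF.aestronglyMeasurable 1 (Eventually.of_forall fun V => ?_)).const_mul _
    have h1 := hF01 (fun i => V (Fin.castAdd (s + 1) i))
    have h2 := hF01 (fun j => V (Fin.natAdd (s + 1) j))
    rw [Real.norm_eq_abs, abs_of_nonneg (mul_nonneg h1.1 h2.1)]
    exact mul_le_one₀ h1.2 h2.1 h2.2
  -- (1) the short cycle is dominated by the open chain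
  have hZQ : ∫ V : Fin (s + 1) → Y, ∏ i, K (V i) (V (i + 1)) ∂(Measure.pi fun _ => μ) ≤
      ∫ W, F W ∂(Measure.pi fun _ : Fin (s + 1) => μ) :=
    integral_mono (hintP (s + 1)) hintF fun V => cyclicProd_le_openProd ha0 ha1 hlo hhi s V
  have hZ0 : 0 ≤ ∫ V : Fin (s + 1) → Y, ∏ i, K (V i) (V (i + 1)) ∂(Measure.pi fun _ => μ) :=
    integral_nonneg fun V => (hP01 (s + 1) V).1
  -- (2) the long cycle dominates e^{-2c} × (open chain)²
  have hQZ : Real.exp (-(2 * c)) * (∫ W, F W ∂(Measure.pi fun _ : Fin (s + 1) => μ)) ^ 2 ≤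
      ∫ V : Fin ((s + 1) + (s + 1)) → Y, ∏ i, K (V i) (V (i + 1)) ∂(Measure.pi fun _ => μ) := by
    have h := integral_mono hintFF (hintP ((s + 1) + (s + 1)))
      fun V => exp_mul_openProd_mul_openProd_le_cyclicProd (s := s) ha0 ha1 hlo hhi V
    rw [integral_const_mul, integral_mul_comp_castAdd_natAdd (μ := μ) (s + 1) F, ← sq] at h
    exact h
  -- (3) assemble
  have hexp : Real.exp (2 * c) * Real.exp (-(2 * c)) = 1 := by rw [← Real.exp_add]; simp
  calc (∫ V : Fin (s + 1) → Y, ∏ i, K (V i) (V (i + 1)) ∂(Measure.pi fun _ => μ)) ^ 2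
      ≤ (∫ W, F W ∂(Measure.pi fun _ : Fin (s + 1) => μ)) ^ 2 := pow_le_pow_left₀ hZ0 hZQ 2
    _ = Real.exp (2 * c) * (Real.exp (-(2 * c)) * (∫ W, F W ∂(Measure.pi fun _ : Fin (s + 1) => μ)) ^ 2) := by
        rw [← mul_assoc, hexp, one_mul]
    _ ≤ Real.exp (2 * c) * ∫ V : Fin ((s + 1) + (s + 1)) → Y, ∏ i, K (V i) (V (i + 1))
          ∂(Measure.pi fun _ => μ) := mul_le_mul_of_nonneg_left hQZ (Real.exp_pos _).le

end Cut

end Summit.QuantumFields.YangMills.Cruxes.IR.ColdPuritySlabDecoupling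

end
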